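import Literature.NumberTheory.PAdicHodge.BmaxPlusTransportedReciprocityInputs
import Literature.NumberTheory.PAdicHodge.FormalTateModuleInclusion
import HarnessLib

/-!
# The per-point Kummer package of the UNIT-ROOT FRAME (ordinary reduction): the `T`-adic Kummer cocycle of a deep formal point through
# `ι : T_pŴ_D ↪ T_pE`, its crystalline Kummer integral `Λ_{Tu}`, and `θ(H_P) = p^N·log_{W_D}(z P)`

Topic `Literature/NumberTheory/PAdicHodge`; THEOREMS ONLY. The ORDINARY twin of `BmaxPlusTransportedReciprocityInputs.exists_transported_kummer_data`
(line `kato_lever`, crux K★ `stmt-BirchSwinnertonDyer-22226`, stub `stub_localFormulaOrdinaryCells`; memo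
`Cruxes/StarredOptimalManinUnitFiveSeven/Lines/kato-lever-seam-rec-at-cells.md` §17). It supplies, for ONE deep formal point `P ∈ E(F)` with a FORMAL
algebraic `p`-power division tower `Q` (all `Qₙ ∈ E₁(ℂ_F)` — at ordinary reduction this is a CHOICE of tower, not automatic), exactly the per-point
hypotheses of `UnitRootFrameReciprocity.exists_const_tatePairingPoint_eq_neg_trace_unitRootFrame`:

* ★★ `exists_kummerPackage_through_iota` — a continuous cocycle `κ` whose level classes are the Kummer classes of `P`, a function `k : Γ_F → ℤ_p` with
  **`κ(σ) = k(σ) • w₀`**, `w₀ = θ_∞⁻¹(ι v₀)` (`v₀` a generator of `T_pŴ_D`, `ι = tateGeomEquivCO⁻¹ ∘ T_p(t ↦ P(t))` of `FormalTateModuleInclusion`),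
  and a crystalline `Λ ∈ B_max⁺` (the period `Λ_N` of the CM-fibre transport `Tu` of the Kummer tower `u = z(Q)`) with the Dieudonné–Honda relation
  `φ²Λ − a_p(E₀)·φΛ + pΛ = 0`, the Kummer identity **`σΛ = Λ + k(σ)·LT(v₀)`** and **`θ(ι(A)fΛ + ι(B)fφΛ) = c_P`** for every Hodge line `(A, B, d)` and
  `ι(c_P) = p^N·Σ'[Xʲ]log_{W_D}·z(P)ʲ`.

All ingredients are tree theorems and HEIGHT-AGNOSTIC: `exists_contOneCocycles_tadicKummer`, `cohomologyMap_tateProjMor_oneCocycleClass_eq_kummerLevelClass`,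
`AinfTop.tateModuleOfPt_kummerCocycleO` (`ι(κ_u σ) = (σQₙ − Qₙ)ₙ`), `exists_unique_int_divisionSeq_of_ramified`, `logSum_transport_kummerCocycleO`,
`AinfTop.frobBmaxPlus_hondaTrace_logSum_divisionLiftPt_eq_zero`, `AinfRamTop.thetaBdR_transportedHodgeCombination_eq`.

HONEST LIMITS: the EXISTENCE of a formal algebraic division tower above a deep point at ordinary reduction (`[p]` onto `Ŵ(𝔪_ℂ)`,
`FormalGroupDivisionHeightOne`, plus `E[pⁿ](ℂ_F) ⊆ E(F̄)`), the frame (`LT`, `v₀`, unit root, Hodge pair, non-vanishing) and the K★ cells are NOT in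
this file; BSD / K★ / [REC-tower] are NOT proved here.

## References
* K. Kato, LNM 1553 (1993), Ch. II §1.4, Thm. 1.4.1, Lemma 1.4.3. [Kato1993LNM1553]
* S. Bloch, K. Kato (1990), Ex. 3.10.1, Example 3.11. [BlochKato1990]
* P. Colmez, Math. Ann. 292 (1992), §2. [Colmez1992PeriodesAbeliennes]
* N. M. Katz, *Crystalline cohomology, Dieudonné modules, and Jacobi sums* (1981), Thm. 5.1.4–5.1.5. [Katz1981CrystallineDieudonne]
* J. H. Silverman, *AEC* (2009), Prop. VII.2.2, VIII §2. [SilvermanAEC2009]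
-/

noncomputable section

open Field Function ValuativeRel WittVector
open scoped Topology

namespace Literature.NumberTheory.PAdicHodge

open Literature.NumberTheory.GaloisRepresentations
open Literature.NumberTheory.GaloisRepresentations.IsNonarchimedeanLocalField
open Literature.NumberTheory.GaloisRepresentations.LubinTate
open Literature.NumberTheory.GaloisCohomology
open Literature.NumberTheory.EllipticCurves
open Literature.NumberTheory.EllipticCurves.FormalGroupChart
open Literature.NumberTheory.PAdicHodge.GaloisContinuity
open Literature.IUT.LogVolume
open Literature.RingTheory.FormalGroups Literature.AlgebraicGeometry.Resolution
open _root_.WeierstrassCurve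

variable {F : Type} [Field F] [ValuativeRel F] [TopologicalSpace F] [IsNonarchimedeanLocalField F] [CharZero F]
  {p : ℕ} [hpp : Fact p.Prime] [Fact (¬ IsUnit (p : integerC F))] [IsAdicComplete (Ideal.span {(p : integerC F)}) (integerC F)]
  (hp : valuation F p < 1) (D : EisensteinRoot F p hp) [CharZero (CompletedAlgClosure F)]
  (W : WeierstrassCurve (EisensteinRoot.CoeffDisc D)) (E₀ : WeierstrassCurve ℤ)
  (hWE : W.map (Ideal.Quotient.mk (Ideal.span {EisensteinRoot.CoeffDisc.of D (AdjoinRoot.root D.poly)})) =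
    (E₀.map (algebraMap ℤ (EisensteinRoot.CoeffDisc D))).map
      (Ideal.Quotient.mk (Ideal.span {EisensteinRoot.CoeffDisc.of D (AdjoinRoot.root D.poly)})))
  (ψ : EisensteinRoot.CoeffDisc D →+* LTCoeff F) (hψ : ∀ c, algebraMap (LTCoeff F) F (ψ c) = EisensteinRoot.CoeffDisc.toF D c)
  [(AinfTop.curveFO F (W.map ψ)).IsElliptic] [(curveOver (CompletedAlgClosure F) (W.map ψ)).IsElliptic]
  [(E₀.map (Int.castRingHom ℚ_[p])).IsElliptic] [(E₀.map (Int.castRingHom (ZMod p))).IsElliptic]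

include hWE hψ in
set_option maxHeartbeats 3200000 in
/-- ★★ **The per-point Kummer package through `ι` (ordinary frame).** Let `LT : T_pŴ_D → A_max` be the transported period map at an index
`N ≥ e` (specification `hLT`, `ℤ_p`-linearity `hsmul`), `v₀` a generator of `T_pŴ_D` (`T_pŴ_D = ℤ_p v₀`), `(A, B, d)` a Hodge line, and
`P ∈ E(F)` a point with a `p`-power division tower `Q` of FORMAL algebraic points (`Q₀ = P`, `‖z(P)‖^N ≤ ‖p‖`) and `ι(c_P) = p^N·Σ'[Xʲ]log_{W_D}·z(P)ʲ`.
Then there are a continuous cocycle `κ` with the Kummer classes of `P` as level classes, `k : Γ_F → ℤ_p` with `κ(σ) = k(σ)•θ_∞⁻¹(ι v₀)`, and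
`Λ ∈ B_max⁺` with `φ²Λ − a_p(E₀)φΛ + pΛ = 0`, `σΛ = Λ + k(σ)·LT(v₀)` and `θ(ι(A)fΛ + ι(B)fφΛ) = c_P`.
[cite: Kato1993LNM1553, Ch. II §1.4 and Lemma 1.4.3] [cite: BlochKato1990, Example 3.11] [cite: Colmez1992PeriodesAbeliennes, §2]
[cite: Katz1981CrystallineDieudonne, Thm. 5.1.4–5.1.5] [cite: SilvermanAEC2009, Prop. VII.2.2 and VIII §2] -/
theorem exists_kummerPackage_through_iota (hΔ : IsUnit (W.map ψ).Δ) {N : ℕ} (hN : D.e ≤ N)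
    {LT : AinfTop.TatePtO F (W.map ψ) p →+ BmaxPlus F p}
    (hLT : ∀ (τ : AinfTop.TatePtO F (W.map ψ) p) (w : ℕ → (maxNilIdealC F).toIdeal) (hw : ∀ n, AinfTop.mulPC F p E₀ (w (n + 1)) = w n)
        (_ : ∀ n, ‖(((w n : (maxNilIdealC F).toIdeal) : CBall F) : CompletedAlgClosure F) -
      (((AinfTop.seqO (W.map ψ) τ n : (maxNilIdealC F).toIdeal) : CBall F) : CompletedAlgClosure F)‖ ≤ ‖((D.rootC : integerC F) : CompletedAlgClosure F)‖)
        (z : bmaxZero F p), algebraMap (Ainf (p := p) F) (bmaxZero F p)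
        ((AinfTop.of F p).symm (((AinfTop.divisionLiftPt E₀ (surjective_fontaineTheta_integerC hp) w hw).val :
          (AinfTop.nilTheta F p (surjective_fontaineTheta_integerC hp)).toIdeal) : AinfTop F p)) ^ N = (p : bmaxZero F p) * z →
        LT τ = PadicLogSeries.logSum ((algebraMap (Ainf (p := p) F) (bmaxZero F p)).comp zpToAinf) (GaloisContinuity.formalLogNum E₀ p) N
          (algebraMap (Ainf (p := p) F) (bmaxZero F p)
            ((AinfTop.of F p).symm (((AinfTop.divisionLiftPt E₀ (surjective_fontaineTheta_integerC hp) w hw).val :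
              (AinfTop.nilTheta F p (surjective_fontaineTheta_integerC hp)).toIdeal) : AinfTop F p))) z)
    (hsmul : ∀ (c : ℤ_[p]) (τ : AinfTop.TatePtO F (W.map ψ) p), LT (c • τ) = ainfToBmaxPlus F p (zpToAinf c) * LT τ)
    {v₀ : AinfTop.TatePtO F (W.map ψ) p} (hgen : ∀ τ : AinfTop.TatePtO F (W.map ψ) p, ∃ c : ℤ_[p], τ = c • v₀)
    (A B : F) (dHL : ℕ)
    (hHL : ∀ n : ℕ, ‖(p : CompletedAlgClosure F) ^ dHL * PowerSeries.coeff n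
        ((W.map ((CBall F).subtype.comp (EisensteinRoot.CoeffDisc.toCBall D))).formalLog -
          PowerSeries.C (algebraMap F (CompletedAlgClosure F) A) * (E₀.map (Int.castRingHom (CompletedAlgClosure F))).formalLog -
          PowerSeries.C (algebraMap F (CompletedAlgClosure F) B) *
            PowerSeries.expand p hpp.out.ne_zero (E₀.map (Int.castRingHom (CompletedAlgClosure F))).formalLog)‖ ≤ 1)
    (P : ((AinfTop.curveFO F (W.map ψ)).baseChange F).toAffine.Point)
    (Q : ℕ → geomPoints ((AinfTop.curveFO F (W.map ψ)).baseChange F)) (hQ : ∀ n, p • Q (n + 1) = Q n)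
    (hQ0 : Q 0 = toGeomPoints ((AinfTop.curveFO F (W.map ψ)).baseChange F) P)
    (hker : ∀ n, AinfTop.geomToCO (W.map ψ) (Q n) ∈ kernel (NormedField.valuation (K := CompletedAlgClosure F))
      (curveOver (CompletedAlgClosure F) (W.map ψ)))
    (huN : ‖((zPt (AinfTop.geomToCO (W.map ψ) (Q 0)) (hker 0) : CBall F) : CompletedAlgClosure F)‖ ^ N ≤ ‖(p : CompletedAlgClosure F)‖)
    (cP : F)
    (hcP : algebraMap F (CompletedAlgClosure F) cP = (p : CompletedAlgClosure F) ^ N *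
        ∑' j : ℕ, PowerSeries.coeff j (W.map ((CBall F).subtype.comp (EisensteinRoot.CoeffDisc.toCBall D))).formalLog *
          ((zPt (AinfTop.geomToCO (W.map ψ) (Q 0)) (hker 0) : CBall F) : CompletedAlgClosure F) ^ j) :
    ∃ (κ : contOneCocycles (restrictedTateRep (AinfTop.curveFO F (W.map ψ)) F p).toTopRep) (k : absoluteGaloisGroup F → ℤ_[p]) (Λ : BmaxPlus F p),
      (∀ j, (cohomologyMap (tateProjMor (AinfTop.curveFO F (W.map ψ)) F p j) 1).hom (oneCocycleClass _ κ) =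
        kummerLevelClass (AinfTop.curveFO F (W.map ψ)) F p j P) ∧
      (∀ σ, κ.1 σ = (k σ • (tateModuleEquiv (AinfTop.curveFO F (W.map ψ)) F p).symm
        ((AinfTop.tateGeomEquivCO F (W.map ψ) p hΔ).symm (tateModuleOfPt (CompletedAlgClosure F) (W.map ψ) p v₀)) :
          (AinfTop.curveFO F (W.map ψ)).tateModule p)) ∧
      frobBmaxPlus F p (frobBmaxPlus F p Λ) -
          ainfToBmaxPlus F p (zpToAinf ((HasseManin.tr (E₀.map (Int.castRingHom (ZMod p))) : ℤ) : ℤ_[p])) * frobBmaxPlus F p Λ +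
            (p : BmaxPlus F p) * Λ = 0 ∧
      (∀ σ, galBmaxPlus σ Λ = Λ + ainfToBmaxPlus F p (zpToAinf (k σ)) * LT v₀) ∧
      thetaBdR (embBdRHom hp (surjective_fontaineTheta_integerC hp) A * bmaxPlusToBdR F p Λ +
          embBdRHom hp (surjective_fontaineTheta_integerC hp) B * bmaxPlusToBdR F p (frobBmaxPlus F p Λ)) =
        algebraMap F (CompletedAlgClosure F) cP := by
  have hN1 : 1 ≤ N := D.e_pos.trans_le hN
  -- the `T`-adic Kummer cocycle of `P` and its level classes
  have hfix : ∀ σ : absoluteGaloisGroup F, σ • Q 0 = Q 0 := gal_smul_divSeq_zero (AinfTop.curveFO F (W.map ψ)) F hQ0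
  obtain ⟨κ, hκ⟩ := exists_contOneCocycles_tadicKummer (AinfTop.curveFO F (W.map ψ)) F p hQ hfix
  have h1 := cohomologyMap_tateProjMor_oneCocycleClass_eq_kummerLevelClass (AinfTop.curveFO F (W.map ψ)) F p hQ hQ0 κ hκ
  -- the formal Kummer cocycle `κ_u` of the tower `u = z(Q)` and its reading through `ι`
  have hup := AinfTop.mulPC_zPt_divSeqO W ψ hψ hQ hker
  have hu₀ := AinfTop.galCBall_zPt_divSeqO_zero W ψ hfix hker
  have hι : ∀ σ, (AinfTop.tateGeomEquivCO F (W.map ψ) p hΔ).symm (tateModuleOfPt (CompletedAlgClosure F) (W.map ψ) p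
      (AinfRamTop.kummerCocycleO W ψ hψ (fun n => zPt (AinfTop.geomToCO (W.map ψ) (Q n)) (hker n)) hup hu₀ σ)) =
      TateModule.mk (fun n => σ • Q n - Q n) (pow_smul_gal_sub_divSeq_eq_zero (AinfTop.curveFO F (W.map ψ)) F p hQ hfix σ)
        (smul_gal_sub_divSeq_succ (AinfTop.curveFO F (W.map ψ)) F p hQ σ) := fun σ => by
    rw [LinearEquiv.symm_apply_eq]
    exact AinfTop.tateModuleOfPt_kummerCocycleO W ψ hψ hΔ hQ hfix hker σ
  -- `κ_u(σ) = k(σ) • v₀`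
  choose k hk using fun σ => hgen (AinfRamTop.kummerCocycleO W ψ hψ (fun n => zPt (AinfTop.geomToCO (W.map ψ) (Q n)) (hker n)) hup hu₀ σ)
  -- the CM-fibre transport `Tu` of the Kummer tower, its depth and witness, and `Λ = Λ_N(Tu)`
  obtain ⟨Tu, ⟨hTu, hTuv⟩, -⟩ := exists_unique_int_divisionSeq_of_ramified D W E₀ hWE
    (v := fun n => zPt (AinfTop.geomToCO (W.map ψ) (Q n)) (hker n)) hup
  have hdepth := norm_transport_zero_pow_le_of_norm_pow_le D (u := fun n => zPt (AinfTop.geomToCO (W.map ψ) (Q n)) (hker n))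
    (Tu := Tu) hTuv hN huN
  have hmem := AinfTop.pow_coe_val_nsmul_divisionLiftPt_mem E₀ (hθ := surjective_fontaineTheta_integerC hp) (u := Tu) hTu hdepth 1
  rw [one_nsmul] at hmem
  obtain ⟨z, hz⟩ := exists_algebraMap_pow_eq_natCast_mul (F := F) (p := p) hmem
  have hz' : algebraMap (Ainf (p := p) F) (bmaxZero F p)
      ((AinfTop.of F p).symm (AinfTop.torsionLift E₀ (surjective_fontaineTheta_integerC hp) Tu hTu)) ^ N = (p : bmaxZero F p) * z := by
    have h := hz
    rw [AinfTop.coe_val_divisionLiftPt] at h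
    exact h
  -- Honda, Kummer identity, `θ`
  have hHonda := AinfTop.frobBmaxPlus_hondaTrace_logSum_divisionLiftPt_eq_zero E₀ (hθ := surjective_fontaineTheta_integerC hp) (u := Tu)
    hTu hN1 hz
  have hKum := fun σ => logSum_transport_kummerCocycleO D W E₀ hWE ψ hψ (hθ := surjective_fontaineTheta_integerC hp) hN hLT
    (u := fun n => zPt (AinfTop.geomToCO (W.map ψ) (Q n)) (hker n)) hup hu₀ huN (Tu := Tu) hTu hTuv hz σ
  have hθb := AinfRamTop.thetaBdR_transportedHodgeCombination_eq D (hθ := surjective_fontaineTheta_integerC hp) W E₀ A B dHL hHL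
    (fun n => zPt (AinfTop.geomToCO (W.map ψ) (Q n)) (hker n)) Tu hup hTu hTuv hN1 hz'
  refine ⟨κ, k, PadicLogSeries.logSum ((algebraMap (Ainf (p := p) F) (bmaxZero F p)).comp zpToAinf) (GaloisContinuity.formalLogNum E₀ p) N
        (algebraMap (Ainf (p := p) F) (bmaxZero F p)
          ((AinfTop.of F p).symm (((AinfTop.divisionLiftPt E₀ (surjective_fontaineTheta_integerC hp) Tu hTu).val :
            (AinfTop.nilTheta F p (surjective_fontaineTheta_integerC hp)).toIdeal) : AinfTop F p))) z,
    h1, fun σ => ?_, ?_, fun σ => ?_, ?_⟩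
  · -- `κ(σ) = θ_∞⁻¹((σQₙ − Qₙ)ₙ) = θ_∞⁻¹(ι(κ_u σ)) = θ_∞⁻¹(ι(k σ • v₀)) = k σ • θ_∞⁻¹(ι v₀)`
    rw [hκ σ, ← hι σ, hk σ]
    exact (congrArg (fun y => (tateModuleEquiv (AinfTop.curveFO F (W.map ψ)) F p).symm ((AinfTop.tateGeomEquivCO F (W.map ψ) p hΔ).symm y))
      (LinearMap.map_smul (tateModuleOfPt (CompletedAlgClosure F) (W.map ψ) p) (k σ) v₀)).trans
      ((congrArg (tateModuleEquiv (AinfTop.curveFO F (W.map ψ)) F p).symm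
        (LinearEquiv.map_smul (AinfTop.tateGeomEquivCO F (W.map ψ) p hΔ).symm (k σ) _)).trans
        (LinearEquiv.map_smul (tateModuleEquiv (AinfTop.curveFO F (W.map ψ)) F p).symm (k σ) _))
  · -- Honda
    have hofp : AdicCompletion.of (Ideal.span {(p : bmaxZero F p)}) (bmaxZero F p) (p : bmaxZero F p) = (p : BmaxPlus F p) :=
      map_natCast (algebraMap (bmaxZero F p) (BmaxPlus F p)) p
    rw [ainfToBmaxPlus_apply, ← hofp]
    exact hHonda
  · -- Kummer identity
    have h := hKum σ
    rw [hk σ, hsmul, eq_sub_iff_add_eq] at h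
    rw [← h, add_comm]
  · -- `θ` (the divisionLiftPt / torsionLift forms of `Λ` agree definitionally, `AinfTop.coe_val_divisionLiftPt`)
    rw [hcP]
    exact hθb

end Literature.NumberTheory.PAdicHodge
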